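import Mathlib.NumberTheory.Cyclotomic.Basic
import Mathlib.RingTheory.Polynomial.Cyclotomic.Roots
import Mathlib.RingTheory.PowerBasis
import Mathlib.FieldTheory.IntermediateField.Algebraic
import Mathlib.FieldTheory.IntermediateField.Adjoin.Basic
import Mathlib.Analysis.SpecialFunctions.Complex.Circle
import Mathlib.Data.ZMod.Basic
import HarnessLib

/-!
# `ℚ(i)`-linear independence of the `p`-th roots of unity: `Σ_d (x_d + i y_d) ζ^d = 0` forces `x, y` constant

COR-CM (cell `pub-hodgecm2`), binder seat b04 (gen 29), count-neutral claim CYCLIC-SEMIDIRECT-EIGHT-DEGENERATE, part VII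
(the arithmetic input of the converse «degenerate ⟹ norm pair»).  Mathlib only.  KERNEL ONLY: theorems; no definition, no
named fact, no `sorry`.  `HC_CM` is neither used nor claimed.

For an odd prime `p` and ANY primitive `p`-th root of unity `ζ ∈ ℂ`:
* §1 `finrank_adjoin_eq_totient`: `[ℚ(ζ_n) : ℚ] = φ(n)` (Mathlib: `minpoly = cyclotomic`); `isPrimitiveRoot_I_mul` (`i·ζ` is a
  primitive `4p`-th root of unity);
* §2 **`I_notMem_adjoin`**: `i ∉ ℚ(ζ)` — otherwise `ℚ(iζ) = ℚ(ζ_{4p}) ⊆ ℚ(ζ)` and `2(p−1) = φ(4p) ≤ φ(p) = p − 1`;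
  `eq_zero_of_add_I_mul_eq_zero`: `u + i v = 0` with `u, v ∈ ℚ(ζ)` forces `u = v = 0`;
* §3 `eq_of_sum_mul_pow_eq_zero`: `Σ_{d ∈ ℤ/p} x_d ζ^d = 0` with `x_d ∈ ℚ` forces `x` constant (the powers `ζ^0, …, ζ^{p−2}`
  are `ℚ`-independent, `Σ_d ζ^d = 0`);
* §4 **`eq_of_sum_gaussian_mul_pow_eq_zero`**: `Σ_d (x_d + y_d i) ζ^d = 0` with `x_d, y_d ∈ ℤ` forces `x` AND `y` constant.
§4 is what turns a vanishing two-sheet determinant of `C_p ⋊ C₈` (`Σ_d (R(d) + i I(d)) ζ^d = 0`, part V) back into the two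
balance identities `R, I` constant — the converse of `CorCM/GaloisCyclicSemidirectEightNormPairs` (part VIII).

## References

* [Washington1997] L. C. Washington, *Introduction to Cyclotomic Fields*, 2nd ed., GTM 83, Prop. 2.4, Thm. 2.5, Ex. 2.3.

Provenance: Literature home (family `hodge`, namespace `Literature.NumberTheory.NumberFields.CyclotomicGaussian`) of the Summits-side `CorCM/CyclotomicGaussianIndependence` (cell `pub-hodgecm2`, COR-CM; all its imports are `Literature/` and Mathlib), which `Literature/` may not import; theorems only, no named fact, no definition. Nothing here bears on `HC_CM`. Lane `lit-hodgefound` (Layer A3: CM types, their Kubota ranks and Galois combinatorics), seat p20.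
-/

noncomputable section

open scoped BigOperators
open Polynomial IntermediateField

namespace Literature.NumberTheory.NumberFields.CyclotomicGaussian

/-! ## §1 Degrees and primitive roots -/

/-- `[ℚ(ζ) : ℚ] = φ(n)` for a primitive `n`-th root of unity `ζ ∈ ℂ`. [cite: Washington1997, Thm. 2.5] -/
theorem finrank_adjoin_eq_totient {n : ℕ} (hn : 0 < n) {ζ : ℂ} (hζ : IsPrimitiveRoot ζ n) :
    Module.finrank ℚ ℚ⟮ζ⟯ = Nat.totient n := by
  rw [adjoin.finrank ((hζ.isIntegral hn).tower_top), ← cyclotomic_eq_minpoly_rat hζ hn, natDegree_cyclotomic]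

/-- `i·ζ` is a primitive `4p`-th root of unity (`p` an odd prime, `ζ` a primitive `p`-th root). [cite: Washington1997, Thm. 2.5] -/
theorem isPrimitiveRoot_I_mul {p : ℕ} (hp : p.Prime) (hp2 : p ≠ 2) {ζ : ℂ} (hζ : IsPrimitiveRoot ζ p) :
    IsPrimitiveRoot (Complex.I * ζ) (4 * p) := by
  have hcop : Nat.Coprime 4 p := by
    rw [show (4 : ℕ) = 2 ^ 2 by norm_num]
    exact (Nat.coprime_primes Nat.prime_two hp |>.2 (Ne.symm hp2)).pow_left 2
  -- `i` is a primitive fourth root of unity (also `Literature.…ModularForms.Level.isPrimitiveRoot_I_four`; inlined to keep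
  -- this file Mathlib-only)
  have hI : IsPrimitiveRoot Complex.I 4 := by
    refine IsPrimitiveRoot.mk_of_lt Complex.I (by norm_num) Complex.I_pow_four fun l hl hl4 => ?_
    interval_cases l
    · rw [pow_one]; intro h; simpa using congrArg Complex.im h
    · rw [Complex.I_sq]; intro h; have := congrArg Complex.re h; norm_num at this
    · rw [pow_succ, Complex.I_sq]; intro h; simpa using congrArg Complex.im h
  have h4 : orderOf Complex.I = 4 := hI.eq_orderOf.symm
  have hpo : orderOf ζ = p := hζ.eq_orderOf.symm
  rw [IsPrimitiveRoot.iff_orderOf, (Commute.all _ _).orderOf_mul_eq_mul_orderOf_of_coprime (by rw [h4, hpo]; exact hcop),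
    h4, hpo]

/-! ## §2 `i ∉ ℚ(ζ_p)` -/

/-- **`i ∉ ℚ(ζ)`** for a primitive `p`-th root of unity `ζ`, `p` an odd prime: else `ℚ(ζ_{4p}) = ℚ(iζ) ⊆ ℚ(ζ)` and
`2(p − 1) = φ(4p) ≤ φ(p) = p − 1`. [cite: Washington1997, Prop. 2.4 and Ex. 2.3] -/
theorem I_notMem_adjoin {p : ℕ} (hp : p.Prime) (hp2 : p ≠ 2) {ζ : ℂ} (hζ : IsPrimitiveRoot ζ p) :
    Complex.I ∉ ℚ⟮ζ⟯ := by
  intro hI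
  have hp0 : 0 < p := hp.pos
  have hη := isPrimitiveRoot_I_mul hp hp2 hζ
  haveI : FiniteDimensional ℚ ℚ⟮ζ⟯ := adjoin.finiteDimensional ((hζ.isIntegral hp0).tower_top)
  have hle : ℚ⟮Complex.I * ζ⟯ ≤ ℚ⟮ζ⟯ := adjoin_simple_le_iff.2 (mul_mem hI (mem_adjoin_simple_self ℚ ζ))
  have hcop : Nat.Coprime 4 p := by
    rw [show (4 : ℕ) = 2 ^ 2 by norm_num]
    exact (Nat.coprime_primes Nat.prime_two hp |>.2 (Ne.symm hp2)).pow_left 2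
  have h4 : Nat.totient 4 = 2 := by decide
  have h := finrank_le_of_le_right hle
  rw [finrank_adjoin_eq_totient (by omega) hη, finrank_adjoin_eq_totient hp0 hζ, Nat.totient_mul hcop,
    Nat.totient_prime hp, h4] at h
  have := hp.two_le
  omega

/-- `u + i·v = 0` with `u, v ∈ ℚ(ζ)` forces `u = v = 0`. [cite: Washington1997, Prop. 2.4] -/
theorem eq_zero_of_add_I_mul_eq_zero {p : ℕ} (hp : p.Prime) (hp2 : p ≠ 2) {ζ : ℂ} (hζ : IsPrimitiveRoot ζ p)
    {u v : ℂ} (hu : u ∈ ℚ⟮ζ⟯) (hv : v ∈ ℚ⟮ζ⟯) (h : u + Complex.I * v = 0) : u = 0 ∧ v = 0 := by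
  by_cases hv0 : v = 0
  · refine ⟨?_, hv0⟩
    rwa [hv0, mul_zero, add_zero] at h
  · exfalso
    apply I_notMem_adjoin hp hp2 hζ
    have hI : Complex.I = -u / v := by
      field_simp
      linear_combination h
    rw [hI]
    exact div_mem (neg_mem hu) hv

/-! ## §3 `Σ_d x_d ζ^d = 0` with rational `x_d` forces `x` constant -/

/-- The powers `ζ^0, …, ζ^{p−2}` of a primitive `p`-th root of unity are `ℚ`-linearly independent in `ℂ`.
[cite: Washington1997, Thm. 2.5] -/
theorem linearIndependent_pow_of_isPrimitiveRoot {p : ℕ} (hp : p.Prime) {ζ : ℂ} (hζ : IsPrimitiveRoot ζ p) :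
    LinearIndependent ℚ fun i : Fin (p - 1) => ζ ^ (i : ℕ) := by
  have hdeg : (minpoly ℚ ζ).natDegree = p - 1 := by
    rw [← cyclotomic_eq_minpoly_rat hζ hp.pos, natDegree_cyclotomic, Nat.totient_prime hp]
  have h := linearIndependent_pow (K := ℚ) ζ
  rw [hdeg] at h
  exact h

/-- `Σ_{d ∈ ℤ/p} x_d ζ^d = 0` with `x_d ∈ ℚ` forces `x_d = x_0` for all `d`. [cite: Washington1997, Thm. 2.5] -/
theorem eq_of_sum_mul_pow_eq_zero {p : ℕ} [Fact p.Prime] {ζ : ℂ} (hζ : IsPrimitiveRoot ζ p) (x : ZMod p → ℚ)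
    (h : ∑ d : ZMod p, (x d : ℂ) * ζ ^ d.val = 0) : ∀ d, x d = x 0 := by
  have hp : p.Prime := Fact.out
  obtain ⟨n, hpn⟩ : ∃ n : ℕ, p = n + 1 := ⟨p - 1, (Nat.succ_pred_eq_of_pos hp.pos).symm⟩
  -- the sum over `ZMod p` as a sum over `ℕ < p`
  have hsum : ∑ d : ZMod p, (x d : ℂ) * ζ ^ d.val = ∑ i ∈ Finset.range p, (x (i : ZMod p) : ℂ) * ζ ^ i := by
    rw [← Fin.sum_univ_eq_sum_range]
    refine (Fintype.sum_bijective (fun i : Fin p => ((i : ℕ) : ZMod p)) ?_ _ _ fun i => ?_).symm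
    · refine (Fintype.bijective_iff_injective_and_card _).2 ⟨fun i j hij => ?_, by simp [ZMod.card]⟩
      have hv := congrArg ZMod.val hij
      rw [ZMod.val_natCast_of_lt i.isLt, ZMod.val_natCast_of_lt j.isLt] at hv
      exact Fin.ext hv
    · simp only [ZMod.val_natCast_of_lt i.isLt]
  have h' : ∑ i ∈ Finset.range (n + 1), (x (i : ZMod p) : ℂ) * ζ ^ i = 0 := by rw [← hpn, ← hsum]; exact h
  rw [Finset.sum_range_succ] at h'
  -- `ζ^n = -Σ_{i<n} ζ^i`
  have hgeom : ∑ i ∈ Finset.range (n + 1), ζ ^ i = 0 := by rw [← hpn]; exact hζ.geom_sum_eq_zero hp.one_lt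
  rw [Finset.sum_range_succ] at hgeom
  have hζn : ζ ^ n = -∑ i ∈ Finset.range n, ζ ^ i := by linear_combination hgeom
  rw [hζn, mul_neg, Finset.mul_sum, ← sub_eq_add_neg, ← Finset.sum_sub_distrib, ← Fin.sum_univ_eq_sum_range] at h'
  -- independence of `ζ^0, …, ζ^{n-1}`
  have hli := linearIndependent_pow_of_isPrimitiveRoot hp hζ
  rw [show p - 1 = n by omega, Fintype.linearIndependent_iff] at hli
  have hcoef := hli (fun i => x ((i : ℕ) : ZMod p) - x (n : ZMod p))
    (by simpa only [Rat.smul_def, Rat.cast_sub, sub_mul] using h')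
  -- conclude: every `x d` equals `x n`, hence `x 0`
  have hall : ∀ d : ZMod p, x d = x (n : ZMod p) := by
    intro d
    obtain ⟨k, hk, rfl⟩ : ∃ k : ℕ, k < p ∧ (k : ZMod p) = d := ⟨d.val, d.val_lt, ZMod.natCast_zmod_val d⟩
    rcases Nat.lt_succ_iff_lt_or_eq.1 (hpn ▸ hk) with hk' | rfl
    · exact sub_eq_zero.1 (hcoef ⟨k, hk'⟩)
    · rfl
  intro d
  rw [hall d, hall 0]

/-! ## §4 Gaussian-integer coefficients -/

/-- **`Σ_d (x_d + y_d·i) ζ^d = 0` with `x_d, y_d ∈ ℤ` forces `x` and `y` constant** (`ζ` any primitive `p`-th root of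
unity, `p` an odd prime): the `ℚ(i)`-linear relations among `ζ^0, …, ζ^{p−1}` are the multiples of `Σ_d ζ^d = 0`.
[cite: Washington1997, Prop. 2.4 and Thm. 2.5] -/
theorem eq_of_sum_gaussian_mul_pow_eq_zero {p : ℕ} [Fact p.Prime] (hp2 : p ≠ 2) {ζ : ℂ} (hζ : IsPrimitiveRoot ζ p)
    (x y : ZMod p → ℤ) (h : ∑ d : ZMod p, ((x d : ℂ) + (y d : ℂ) * Complex.I) * ζ ^ d.val = 0) :
    (∀ d, x d = x 0) ∧ (∀ d, y d = y 0) := by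
  have hp : p.Prime := Fact.out
  have hsplit : (∑ d : ZMod p, (x d : ℂ) * ζ ^ d.val) + Complex.I * (∑ d : ZMod p, (y d : ℂ) * ζ ^ d.val) = 0 := by
    rw [Finset.mul_sum, ← Finset.sum_add_distrib, ← h]
    exact Finset.sum_congr rfl fun d _ => by ring
  have hmem : ∀ z : ZMod p → ℤ, (∑ d : ZMod p, (z d : ℂ) * ζ ^ d.val) ∈ ℚ⟮ζ⟯ := fun z =>
    sum_mem fun d _ => mul_mem (intCast_mem ℚ⟮ζ⟯ (z d)) (pow_mem (mem_adjoin_simple_self ℚ ζ) _)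
  obtain ⟨hx, hy⟩ := eq_zero_of_add_I_mul_eq_zero hp hp2 hζ (hmem x) (hmem y) hsplit
  have hx' := eq_of_sum_mul_pow_eq_zero hζ (fun d => (x d : ℚ)) (by exact_mod_cast hx)
  have hy' := eq_of_sum_mul_pow_eq_zero hζ (fun d => (y d : ℚ)) (by exact_mod_cast hy)
  exact ⟨fun d => by exact_mod_cast hx' d, fun d => by exact_mod_cast hy' d⟩

end Literature.NumberTheory.NumberFields.CyclotomicGaussian

end
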